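import Literature.MathematicalPhysics.KineticTheory.SiteChainUniformMinorization
import Literature.MathematicalPhysics.KineticTheory.CellChainLangevin
import Literature.Probability.Process.KrylovBogoliubov
import Summits.AtomisticToContinuum.FouriersLaw.Theorems.MatthiessenLadderPrefixSteadyStatesStubCellChainInvariantUnique
import Summits.AtomisticToContinuum.FouriersLaw.Theorems.MatthiessenLadderPrefixSteadyStatesStubCellChainInvariantOfSteadyState
import Summits.AtomisticToContinuum.FouriersLaw.Theorems.OddSectorIrreversibilityResponseDensityHarrisUniform
import Summits.AtomisticToContinuum.FouriersLaw.Theses.MatthiessenLadder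
import HarnessLib

/-!
# Uniform exponential mixing of the Langevin kernels of a cell chain from a uniform high-energy decay

Helper for crux `PrefixSteadyStates` (route `MatthiessenLadder`, item stmt-AtomisticToContinuum-12778,
registered stub `stub_prefixMixingOfDecay` of the line `registered`). For the kernels
`P^δ_t = (cellChain ω₂ lam β γ c).langevinKernel N (T + δ/2) (T - δ/2) t`, `|δ| < δ₀ < 2T`, and the
Lyapunov function `V = e^{ϑH}` (`ϑ(T + δ₀/2) < 1`), the exponential convergence (2.5) of
Cuneo–Eckmann–Hairer–Rey-Bellet 2018 with constants UNIFORM in the bias `δ`, together with invariant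
probability measures `ν_δ` with `ν_δ(e^{ϑH}) ≤ C`, is derived from two displayed inputs: the a-priori
bound (3.4) `P^δ_t V ≤ e^{ϑγ(T_L+T_R)t} V` and a uniform high-energy decay
`P^δ_{t⋆} V ≤ V/2` on `{H ≥ E₁}`. This is a PORT of the pinned chain's uniform Harris assembly
(`…OddSectorIrreversibilityCorrectorTheoryUniformMixing.lean`):

* uniform DRIFT at time `1` from the decay and (3.4), iterated to integer times
  (`Harris.lintegral_pow_le_of_drift`);
* uniform MINORISATION on `{V ≤ R}` at an integer time: the SiteChain layer
  `SiteChain.UniformlyConfining.exists_uniform_minorization_sublevel` (model-free uniform local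
  minorisation `ConfinedDrift.minorization_at_one_uniform`, finite subcover of the temperature band,
  uniform LaSalle reachability, Chapman–Kolmogorov) fed with the cell-chain inputs of
  `…StubCellChainInvariantUnique.lean` (Kalman at `0` from the left bath, `V_i'` injective, `0` the
  only critical point) and the coercivity `…StubCellChainInvariantOfSteadyState.lean`;
* the abstract uniform Harris theorem `uniformHarris_semigroup` (`…ResponseDensityHarrisUniform.lean`);
* EXISTENCE of invariant probability measures by Krylov–Bogoliubov
  (`MarkovSemigroup.exists_invariant_of_lyapunov`) and the moment bound
  `Harris.lintegral_le_of_invariant`.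
-/

noncomputable section

open MeasureTheory ProbabilityTheory Filter Topology Set Metric
open scoped NNReal ENNReal

namespace Summit.AtomisticToContinuum.FouriersLaw.Theorems.PrefixSteadyStates.LineRegistered

open Literature.MathematicalPhysics.KineticTheory.HeatConduction
open Literature.MathematicalPhysics.KineticTheory Literature.Probability.Process

variable {N : ℕ}

/-- The equilibrium of a cell chain has zero energy. [folklore] -/
theorem cellChain_hamiltonian_zero_U7 (ω₂ lam β γ : ℝ) (c : ℕ → Bool) (N : ℕ) :
    (cellChain ω₂ lam β γ c).hamiltonian N 0 = 0 := by
  simp [SiteChain.hamiltonian, cellChain]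

/-- **Local coercivity of the energy of a cell chain at the equilibrium** (`ω₂ > 0`, `lam, β ≥ 0`):
for every `ρ > 0` there is `η₀ > 0 = H(0)` with `{H < η₀} ⊆ B(0, ρ)`. [folklore] -/
theorem cellChain_coercive_U7 {ω₂ lam β : ℝ} (hω : 0 < ω₂) (hl : 0 ≤ lam) (hβ : 0 ≤ β) (γ : ℝ)
    (c : ℕ → Bool) (N : ℕ) (ρ : ℝ) (hρ : 0 < ρ) :
    ∃ η₀ : ℝ, (cellChain ω₂ lam β γ c).hamiltonian N 0 < η₀ ∧
      ∀ x : PhaseSpace N, (cellChain ω₂ lam β γ c).hamiltonian N x < η₀ → ‖x‖ < ρ := by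
  set η₀ : ℝ := min ω₂ 1 * ρ ^ 2 / 4 with hη₀
  have hη₀pos : 0 < η₀ := by rw [hη₀]; positivity
  refine ⟨η₀, by rw [cellChain_hamiltonian_zero_U7]; exact hη₀pos, fun x hx => ?_⟩
  have hmem := cellChain_setOf_hamiltonian_le_subset_closedBall hω hl hβ γ c N η₀ (le_of_lt hx)
  rw [mem_closedBall, dist_zero_right] at hmem
  have hmin1 : min ω₂ 1 ≤ 1 := min_le_right _ _
  have hminω : min ω₂ 1 ≤ ω₂ := min_le_left _ _
  have hmin0 : 0 < min ω₂ 1 := lt_min hω one_pos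
  have h1 : 2 * η₀ / ω₂ ≤ ρ ^ 2 / 2 := by
    rw [div_le_iff₀ hω, hη₀]
    nlinarith [sq_nonneg ρ]
  have h2 : 2 * η₀ ≤ ρ ^ 2 / 2 := by rw [hη₀]; nlinarith [sq_nonneg ρ]
  have h3 : Real.sqrt (ρ ^ 2 / 2) < ρ := by
    rw [Real.sqrt_lt' hρ]
    nlinarith
  have h4 : max (Real.sqrt (2 * η₀ / ω₂)) (Real.sqrt (2 * η₀)) ≤ Real.sqrt (ρ ^ 2 / 2) :=
    max_le (Real.sqrt_le_sqrt h1) (Real.sqrt_le_sqrt h2)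
  exact hmem.trans_lt (h4.trans_lt h3)

set_option maxHeartbeats 1600000 in
/-- **Registered stub `stub_prefixMixingOfDecay` of crux `PrefixSteadyStates` (line `registered`):
CEHR (2.5) with constants uniform in the temperature bias, with invariant probability measures, from
(3.4) and a uniform high-energy decay** — uniform drift at time one from the decay, uniform
minorisation on the sublevel sets of `e^{ϑH}` (`exists_uniform_minorization_sublevel` with the
cell-chain Kalman/LaSalle/coercivity inputs), the uniform Harris theorem, Krylov–Bogoliubov.
[cite: CuneoEckmannHairerReyBellet2018, Thm 2.13 (3) (proof)] [cite: HairerMattingly2011, Thm 1.2] -/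
theorem stub_prefixMixingOfDecay :
    ∀ ω₂ lam β γ : ℝ, 0 < ω₂ → 0 ≤ lam → 0 ≤ β → 0 < γ → ∀ (c : ℕ → Bool) (N : ℕ), 0 < N →
      ∀ T δ₀ ϑ : ℝ, 0 < T → 0 < δ₀ → δ₀ < 2 * T → 0 < ϑ → ϑ * (T + δ₀ / 2) < 1 →
        (∀ δ : ℝ, |δ| < δ₀ → ∀ θ : ℝ, 0 < θ → θ < 1 / max (T + δ / 2) (T - δ / 2) →
          ∀ (t : ℝ≥0) (z : PhaseSpace N),
            ∫⁻ y, ENNReal.ofReal (Real.exp (θ * (cellChain ω₂ lam β γ c).hamiltonian N y))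
                ∂((cellChain ω₂ lam β γ c).langevinKernel N (T + δ / 2) (T - δ / 2) t z) ≤
              ENNReal.ofReal (Real.exp (θ * γ * ((T + δ / 2) + (T - δ / 2)) * t) *
                Real.exp (θ * (cellChain ω₂ lam β γ c).hamiltonian N z))) →
        (∀ tstar : ℝ≥0, 0 < tstar → ∃ E₁ : ℝ, ∀ δ : ℝ, |δ| < δ₀ → ∀ z : PhaseSpace N,
          E₁ ≤ (cellChain ω₂ lam β γ c).hamiltonian N z →
            ∫⁻ y, ENNReal.ofReal (Real.exp (ϑ * (cellChain ω₂ lam β γ c).hamiltonian N y))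
                ∂((cellChain ω₂ lam β γ c).langevinKernel N (T + δ / 2) (T - δ / 2) tstar z) ≤
              ENNReal.ofReal (Real.exp (ϑ * (cellChain ω₂ lam β γ c).hamiltonian N z) / 2)) →
        ∃ C r : ℝ, 0 ≤ C ∧ 0 < r ∧ ∀ δ : ℝ, |δ| < δ₀ →
          ∃ ν : Measure (PhaseSpace N), IsProbabilityMeasure ν ∧
            (∀ t : ℝ≥0, ProbabilityTheory.Kernel.Invariant
              ((cellChain ω₂ lam β γ c).langevinKernel N (T + δ / 2) (T - δ / 2) t) ν) ∧
            (∫ y, Real.exp (ϑ * (cellChain ω₂ lam β γ c).hamiltonian N y) ∂ν ≤ C) ∧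
            ∀ (z : PhaseSpace N) (t : ℝ≥0) (f : PhaseSpace N → ℝ), Continuous f →
              (∀ y, |f y| ≤ Real.exp (ϑ * (cellChain ω₂ lam β γ c).hamiltonian N y)) →
              |(∫ y, f y ∂((cellChain ω₂ lam β γ c).langevinKernel N (T + δ / 2) (T - δ / 2) t z)) -
                  ∫ y, f y ∂ν| ≤
                C * Real.exp (ϑ * (cellChain ω₂ lam β γ c).hamiltonian N z) * Real.exp (-r * t) := by
  intro ω₂ lam β γ hω hl hβ hγ c N hN T δ₀ ϑ hT hδ₀ hδ₀T hϑ hϑT h34 hdecay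
  set Pc := cellChain ω₂ lam β γ c with hPcdef
  have hPc : Pc.UniformlyConfining := cellChain_uniformlyConfining hω hl hβ hγ.le c
  set Hm := Pc.hamiltonian N with hHm
  have hHc : Continuous Hm := (hPc.contDiff_hamiltonian N).continuous
  have hH0 : ∀ z, 0 ≤ Hm z := fun z => hPc.hamiltonian_nonneg N z
  -- bath facts for `|δ| < δ₀`
  have hbath : ∀ δ : ℝ, |δ| < δ₀ → 0 < T + δ / 2 ∧ 0 < T - δ / 2 ∧
      ϑ < 1 / max (T + δ / 2) (T - δ / 2) := by
    intro δ hδ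
    have h1 := abs_lt.1 hδ
    have hL : 0 < T + δ / 2 := by linarith
    have hR : 0 < T - δ / 2 := by linarith
    refine ⟨hL, hR, ?_⟩
    rw [lt_div_iff₀ (lt_max_of_lt_left hL)]
    rcases le_total (T + δ / 2) (T - δ / 2) with h | h
    · rw [max_eq_right h]; nlinarith
    · rw [max_eq_left h]; nlinarith
  -- the family of kernels and its algebra
  set κ : ℝ → ℝ≥0 → Kernel (PhaseSpace N) (PhaseSpace N) :=
    fun δ t => Pc.langevinKernel N (T + δ / 2) (T - δ / 2) t with hκ
  haveI hMk : ∀ (δ : ℝ) (t : ℝ≥0), IsMarkovKernel (κ δ t) := fun δ t =>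
    hPc.isMarkovKernel_langevinKernel N _ _ t
  have h_zero : ∀ δ : ℝ, κ δ 0 = Kernel.id := fun δ => hPc.langevinKernel_zero N _ _
  have h_add : ∀ (δ : ℝ) (s t : ℝ≥0), κ δ (s + t) = κ δ t ∘ₖ κ δ s := fun δ s t =>
    hPc.langevinKernel_add N _ _ s t
  have h_pow : ∀ (δ : ℝ) (n : ℕ), κ δ (n : ℝ≥0) = κ δ 1 ^ n := by
    intro δ n
    have h := MarkovSemigroup.kernel_nat_mul_eq_pow (κ δ) (h_zero δ) (h_add δ) 1 n
    rwa [mul_one] at h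
  -- the Lyapunov function `V = e^{ϑH}`
  set V : PhaseSpace N → ℝ≥0 := fun z => (Real.exp (ϑ * Hm z)).toNNReal with hVdef
  have hVc : Continuous V := continuous_real_toNNReal.comp (Real.continuous_exp.comp (continuous_const.mul hHc))
  have hV : Measurable V := hVc.measurable
  have hVcoe : ∀ z, (V z : ℝ≥0∞) = ENNReal.ofReal (Real.exp (ϑ * Hm z)) := fun z => rfl
  have hVreal : ∀ z, (V z : ℝ) = Real.exp (ϑ * Hm z) := fun z => Real.coe_toNNReal _ (Real.exp_pos _).le
  have hV1 : ∀ z, 1 ≤ Real.exp (ϑ * Hm z) := fun z => Real.one_le_exp (mul_nonneg hϑ.le (hH0 z))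
  -- the flow bound (3.4), uniform: `C⋆ = ϑγ(2T)`
  set Cstar : ℝ := ϑ * γ * (2 * T) with hCstar
  have hCstar0 : 0 ≤ Cstar := by positivity
  have hflow : ∀ δ : ℝ, |δ| < δ₀ → ∀ (s : ℝ≥0) (x : PhaseSpace N),
      ∫⁻ y, (V y : ℝ≥0∞) ∂(κ δ s x) ≤ ENNReal.ofReal (Real.exp (Cstar * s)) * V x := by
    intro δ hδ s x
    obtain ⟨-, -, hϑ'⟩ := hbath δ hδ
    have h := h34 δ hδ ϑ hϑ hϑ' s x
    simp only [hVcoe]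
    refine h.trans (le_of_eq ?_)
    rw [ENNReal.ofReal_mul (Real.exp_pos _).le]
    congr 3
    rw [hCstar]; ring
  -- UDRIFT at time `1`, from the decay above `E₁` and (3.4) below
  obtain ⟨E₁, hE₁⟩ := hdecay 1 one_pos
  set K₀ : ℝ := Real.exp Cstar * Real.exp (ϑ * max E₁ 0) with hK₀
  have hK₀0 : 0 ≤ K₀ := by positivity
  set a : ℝ≥0 := (1 / 2 : ℝ).toNNReal with ha
  set b₀ : ℝ≥0 := K₀.toNNReal with hb₀
  have ha1 : a < 1 := by
    rw [← NNReal.coe_lt_coe, ha, Real.coe_toNNReal _ (by norm_num), NNReal.coe_one]; norm_num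
  have hdriftV : ∀ δ : ℝ, |δ| < δ₀ → ∀ z, ∫⁻ y, (V y : ℝ≥0∞) ∂(κ δ 1 z) ≤ (a : ℝ≥0∞) * V z + b₀ := by
    intro δ hδ z
    simp only [hVcoe]
    have ea : (a : ℝ≥0∞) = ENNReal.ofReal (1 / 2) := rfl
    have eb : (b₀ : ℝ≥0∞) = ENNReal.ofReal K₀ := rfl
    rw [ea, eb, ← ENNReal.ofReal_mul (by norm_num), ← ENNReal.ofReal_add (by positivity) hK₀0]
    by_cases hz : E₁ ≤ Hm z
    · refine (hE₁ δ hδ z hz).trans (ENNReal.ofReal_le_ofReal ?_)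
      linarith
    · obtain ⟨-, -, hϑ'⟩ := hbath δ hδ
      have h := h34 δ hδ ϑ hϑ hϑ' 1 z
      refine h.trans (ENNReal.ofReal_le_ofReal ?_)
      have h1 : Real.exp (ϑ * γ * ((T + δ / 2) + (T - δ / 2)) * ((1 : ℝ≥0) : ℝ)) = Real.exp Cstar := by
        rw [NNReal.coe_one, mul_one, hCstar]; ring_nf
      have h2 : Real.exp (ϑ * Hm z) ≤ Real.exp (ϑ * max E₁ 0) :=
        Real.exp_le_exp.2 (mul_le_mul_of_nonneg_left ((not_le.1 hz).le.trans (le_max_left _ _)) hϑ.le)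
      rw [h1]
      have h3 : Real.exp Cstar * Real.exp (ϑ * Hm z) ≤ K₀ := by
        rw [hK₀]; exact mul_le_mul_of_nonneg_left h2 (Real.exp_pos _).le
      have h4 : 0 ≤ 1 / 2 * Real.exp (ϑ * Hm z) := by positivity
      linarith
  -- the skeleton drift at integer times
  set B : ℝ≥0 := b₀ / (1 - a) with hB
  have h1a : 0 < 1 - a := tsub_pos_of_lt ha1
  set R : ℝ≥0 := (2 * B + 1) / (1 - a) with hRdef
  have hRa : (1 - a) * R = 2 * B + 1 := by rw [hRdef, mul_comm, div_mul_cancel₀ _ h1a.ne']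
  have hR1' : (1 : ℝ≥0) ≤ R := by
    rw [hRdef, le_div_iff₀ h1a, one_mul]
    exact tsub_le_self.trans le_add_self
  have hR1 : (1 : ℝ) ≤ R := by exact_mod_cast hR1'
  have hdriftn : ∀ δ : ℝ, |δ| < δ₀ → ∀ (n : ℕ) z,
      ∫⁻ y, (V y : ℝ≥0∞) ∂(κ δ (n : ℝ≥0) z) ≤ ((a ^ n : ℝ≥0) : ℝ≥0∞) * V z + B := by
    intro δ hδ n z
    rw [h_pow δ n, ENNReal.coe_pow]
    exact Harris.lintegral_pow_le_of_drift (κ δ 1) hV ha1 (hdriftV δ hδ) n z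
  -- the energy level of the sublevel set `{V ≤ R}`
  set E : ℝ := Real.log R / ϑ with hE
  have hVE : ∀ x : PhaseSpace N, V x ≤ R → Hm x ≤ E := by
    intro x hx
    have hx' : Real.exp (ϑ * Hm x) ≤ R := by
      have : ((V x : ℝ≥0) : ℝ) ≤ R := by exact_mod_cast hx
      rwa [hVreal] at this
    rw [hE, le_div_iff₀ hϑ, mul_comm, Real.le_log_iff_exp_le (by linarith)]
    exact hx'
  -- UMINOR on `{H ≤ E}` at an integer time, uniformly in the band
  have hVinj : ∀ i, Function.Injective (deriv (Pc.V i)) := fun i => cellChain_deriv_V_injective_U3 ω₂ lam hβ γ c i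
  have hcrit : ∀ q : Fin N → ℝ, (∀ i, Pc.dPotential N i q = 0) → q = 0 :=
    fun q hq => cellChain_eq_zero_of_dPotential_eq_zero_U3 hω hl hβ γ c N q hq
  have hY0 : Pc.langevinDrift N 0 = 0 := cellChain_langevinDrift_zero_U3 ω₂ lam β γ c N
  have hKal : ∀ T_L : ℝ, 0 < T_L → ∀ ℓ : PhaseSpace N →ₗ[ℝ] ℝ,
      (∀ j : ℕ, ℓ (((fderiv ℝ (Pc.langevinDrift N) 0) ^ j) (Pc.noiseVecL N T_L)) = 0) → ℓ = 0 :=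
    fun T_L hTL ℓ h => cellChain_kalman_noiseVecL_U3 hγ c hN hTL ℓ h
  have hcoer : ∀ ρ : ℝ, 0 < ρ → ∃ η₀ : ℝ, Hm 0 < η₀ ∧ ∀ x : PhaseSpace N, Hm x < η₀ → ‖x‖ < ρ :=
    fun ρ hρ => cellChain_coercive_U7 hω hl hβ γ c N ρ hρ
  obtain ⟨n, α, νm, hn, hα, hνm, hminor⟩ := hPc.exists_uniform_minorization_sublevel N (by exact hγ) hN
    hVinj hcrit hY0 hKal hcoer hδ₀.le hδ₀T E
  have hn0 : n ≠ 0 := Nat.pos_iff_ne_zero.1 hn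
  -- the conditions of the uniform Harris theorem
  have hγ' : a ^ n < 1 := pow_lt_one₀ zero_le ha1 hn0
  have hRcond : 2 * B < (1 - a ^ n) * R := by
    have ham : a ^ n ≤ a := pow_le_of_le_one zero_le ha1.le hn0
    calc 2 * B < 2 * B + 1 := lt_add_one _
      _ = (1 - a) * R := hRa.symm
      _ ≤ (1 - a ^ n) * R := mul_le_mul_of_nonneg_right (tsub_le_tsub_left ham 1) zero_le
  have ht₀ : (0 : ℝ≥0) < (n : ℝ≥0) := by exact_mod_cast hn
  -- the family indexed by the band
  set ι := {δ : ℝ // |δ| < δ₀}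
  set κ' : ι → ℝ≥0 → Kernel (PhaseSpace N) (PhaseSpace N) := fun i t => κ i.1 t with hκ'
  haveI : ∀ (i : ι) (t : ℝ≥0), IsMarkovKernel (κ' i t) := fun i t => hMk i.1 t
  haveI : Nonempty (PhaseSpace N) := ⟨0⟩
  obtain ⟨Ch, ch, hCh, hch, hconv⟩ := uniformHarris_semigroup κ' (fun i => h_zero i.1) (fun i s t => h_add i.1 s t)
    hV ht₀ hγ' (fun i z => hdriftn i.1 i.2 n z) hα hRcond (fun _ => νm)
    (fun i x hx => hminor i.1 i.2.le x (hVE x hx)) hCstar0 (fun i s x => hflow i.1 i.2 s x)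
  -- the moment bound of invariant probability measures
  set Mb : ℝ := ((B / (1 - a ^ n) : ℝ≥0) : ℝ) with hMb
  have hMb0 : 0 ≤ Mb := NNReal.coe_nonneg _
  -- compact sublevel sets of `V` (for Krylov–Bogoliubov)
  have hcpt : ∀ R' : ℝ≥0, IsCompact {x : PhaseSpace N | V x ≤ R'} := by
    intro R'
    refine (hPc.isCompact_setOf_hamiltonian_le N (Real.log (max (R' : ℝ) 1) / ϑ)).of_isClosed_subset
      (isClosed_le hVc continuous_const) fun x hx => ?_
    have hx' : Real.exp (ϑ * Hm x) ≤ max (R' : ℝ) 1 := by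
      have : ((V x : ℝ≥0) : ℝ) ≤ R' := by exact_mod_cast hx
      rw [hVreal] at this
      exact this.trans (le_max_left _ _)
    show Hm x ≤ Real.log (max (R' : ℝ) 1) / ϑ
    rw [le_div_iff₀ hϑ, mul_comm, Real.le_log_iff_exp_le (by positivity)]
    exact hx'
  refine ⟨max (2 * Ch) Mb, ch, le_max_of_le_right hMb0, hch, fun δ hδ => ?_⟩
  -- existence of an invariant probability measure (Krylov–Bogoliubov)
  have hlyap : ∀ _i : Unit, ∃ (tstar : ℝ≥0) (a' b' c' : ℝ≥0∞), 0 < tstar ∧ a' < 1 ∧ b' ≠ ∞ ∧ c' ≠ ∞ ∧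
      (∀ x, ∫⁻ y, ((fun (_ : Unit) => V) _i) y ∂(κ δ tstar x) ≤ a' * ((fun (_ : Unit) => V) _i) x + b') ∧
      (∀ r : ℝ≥0, r < tstar → ∀ x, ∫⁻ y, ((fun (_ : Unit) => V) _i) y ∂(κ δ r x) ≤
        c' * ((fun (_ : Unit) => V) _i) x) := by
    intro _
    refine ⟨1, a, b₀, ENNReal.ofReal (Real.exp Cstar), one_pos, by exact_mod_cast ha1,
      ENNReal.coe_ne_top, ENNReal.ofReal_ne_top, hdriftV δ hδ, fun r hr x => ?_⟩
    refine (hflow δ hδ r x).trans (mul_le_mul_of_nonneg_right (ENNReal.ofReal_le_ofReal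
      (Real.exp_le_exp.2 ?_)) zero_le)
    have hr' : ((r : ℝ≥0) : ℝ) ≤ 1 := by exact_mod_cast hr.le
    exact mul_le_of_le_one_right hCstar0 hr'
  obtain ⟨μ, hμ, hinv, -⟩ := MarkovSemigroup.exists_invariant_of_lyapunov (κ δ) (h_zero δ) (h_add δ)
    (hPc.measurable_langevinKernel N _ _) (fun t g => hPc.continuous_integral_langevinKernel_bcf N _ _ t g)
    (fun _ : Unit => V) (fun _ => hVc) hlyap () hcpt 0
  haveI := hμ
  refine ⟨μ, hμ, hinv, ?_, fun z t f hf hfb => ?_⟩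
  · -- the moment bound
    have hμVle : ∫⁻ x, (V x : ℝ≥0∞) ∂μ ≤ ((B / (1 - a ^ n) : ℝ≥0) : ℝ≥0∞) :=
      Harris.lintegral_le_of_invariant (κ δ n) hV hγ' (hdriftn δ hδ n) (hinv n)
    have e : (fun y => Real.exp (ϑ * Hm y)) = fun y => (V y : ℝ) := funext fun y => (hVreal y).symm
    show ∫ y, Real.exp (ϑ * Hm y) ∂μ ≤ max (2 * Ch) Mb
    rw [e, Harris.integral_coe_eq_toReal hV]
    exact (ENNReal.toReal_le_coe_of_le_coe hμVle).trans (le_max_right _ _)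
  · -- the uniform mixing
    have h := hconv ⟨δ, hδ⟩ μ hμ (fun t => hinv t) z t f hf.measurable (fun y => by rw [hVreal]; exact hfb y)
    rw [hVreal] at h
    have hC2 : 2 * Ch ≤ max (2 * Ch) Mb := le_max_left _ _
    calc _ ≤ Ch * (1 + Real.exp (ϑ * Hm z)) * Real.exp (-ch * t) := h
      _ ≤ Ch * (2 * Real.exp (ϑ * Hm z)) * Real.exp (-ch * t) := by
          refine mul_le_mul_of_nonneg_right (mul_le_mul_of_nonneg_left (by linarith [hV1 z]) hCh.le)
            (Real.exp_pos _).le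
      _ = (2 * Ch) * Real.exp (ϑ * Hm z) * Real.exp (-ch * t) := by ring
      _ ≤ max (2 * Ch) Mb * Real.exp (ϑ * Hm z) * Real.exp (-ch * t) := by
          gcongr

end Summit.AtomisticToContinuum.FouriersLaw.Theorems.PrefixSteadyStates.LineRegistered

end
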